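import Summits.CriticalPhenomena.CardyFormulaZ2.Theorems.CardyUniqueLimitCardyRigidityDefs
import Literature.Probability.RandomPlanarGeometry.LoewnerRealKoebe

/-!
# Pathwise far-field control of the three mark flows up to the level time (line `crossing-martingale`, crux `CardyRigidity`)

Deterministic (one sample path) lemmas for the far-field MOMENT expansion of the level-stopped
modulus `etaProc` of a regular driving process (stubs `stub_betaPinning` / `stub_kernelAffineBeta`
of crux `CardyRigidity`, stmt-CriticalPhenomena-0746; vocabulary of
`Theorems/CardyUniqueLimitCardyRigidityDefs.lean`).  For a continuous path `W ω` with `W ω 0 = 0`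
and admissible marks/levels `(x, m, M, d)`:

* `flows_of_le_levelTime` — up to the level time no mark is swallowed, the first flow stays in
  `[m, M]`, every flow is `Xⁱ_u = xᵢ - W_u + Iⁱ_u` with the Loewner drift integral
  `Iⁱ_u = ∫₀ᵘ 2/Xⁱ_s ds ∈ [0, 2u/m]` (the integrand is in `(0, 2/m]` because `Xⁱ ≥ X⁰ ≥ m`);
  hence the gaps move by at most `2u/m` and every mark is within `max(x₀-m, M-x₀) + 2u/m` of its
  starting point (`abs_markFlow_sub_le_of_le_levelTime`);
* `coe_lt_levelTime_of_forall_abs_le` — on the event `sup_{u ≤ t} |W_u| ≤ K` with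
  `K + 2t/m < min(x₀-m, M-x₀)` and `2t/m < min(x₁-x₀-d, x₂-x₁-d, 1)` the level time is `> t`, and the
  drift integrals are `2t/xᵢ + O((K + 2t/m)/xᵢ²)` (`abs_driftIntegral_sub_le`).

No probability here; the probabilistic layer integrates these bounds against the `L³` domination
of `IsRegularDriver`.
-/

noncomputable section

open MeasureTheory Filter Set Topology
open scoped NNReal ENNReal Interval
open Literature.Probability.RandomPlanarGeometry
open Literature.Probability.Process (exitTime coe_untopA_min_le)

namespace Summit.CriticalPhenomena.CardyFormulaZ2.Cruxes.CardyRigidity.CrossingMartingale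

namespace FarField

variable {Ω : Type*} {W : Ω → ℝ≥0 → ℝ} {ω : Ω} {x : Fin 3 → ℝ} {m M d : ℝ}

/-- **The three flows up to the level time.**  For a continuous path with `W ω 0 = 0` and
admissible data, at every time `u ≤ levelTime`: no mark is swallowed, `X⁰_u ∈ [m, M]`,
`Xⁱ_u = xᵢ - W_u + ∫₀ᵘ 2/Xⁱ_s ds` with `0 ≤ ∫₀ᵘ 2/Xⁱ_s ds ≤ 2u/m`, and `m ≤ X⁰_s ≤ Xⁱ_s` on
`[0, u]`. [cite: Lawler2005, Prop. 1.21] -/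
theorem flows_of_le_levelTime (hWc : Continuous (W ω)) (hW0 : W ω 0 = 0)
    (h : AdmissibleLevels x m M d) {u : ℝ≥0}
    (hu : (u : WithTop ℝ≥0) ≤ levelTime W x m M d ω) :
    (∀ i, (u : WithTop ℝ≥0) < Loewner.swallowingTime (W ω) (x i)) ∧
      markFlow W (x 0) u ω ∈ Icc m M ∧
      (∀ i, markFlow W (x i) u ω =
        x i - W ω u + ∫ s in (0 : ℝ)..(u : ℝ), (2 : ℝ) / markFlow W (x i) s.toNNReal ω) ∧
      (∀ i, 0 ≤ ∫ s in (0 : ℝ)..(u : ℝ), (2 : ℝ) / markFlow W (x i) s.toNNReal ω) ∧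
      (∀ i, (∫ s in (0 : ℝ)..(u : ℝ), (2 : ℝ) / markFlow W (x i) s.toNNReal ω) ≤ 2 * u / m) ∧
      (∀ i, ∀ s : ℝ≥0, s ≤ u → m ≤ markFlow W (x i) s ω) := by
  have hx0 : 0 < x 0 := h.pos
  have hxpos : ∀ i, 0 < x i := fun i ↦ hx0.trans_le (h.strictMono.monotone (Fin.zero_le i))
  have hx0le : ∀ i, x 0 ≤ x i := fun i ↦ h.strictMono.monotone (Fin.zero_le i)
  have hW0lt : ∀ i, W ω 0 < x i := fun i ↦ by rw [hW0]; exact hxpos i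
  have hne : ∀ i, x i ≠ W ω 0 := fun i ↦ (hW0lt i).ne'
  have hcont : ∀ i, Continuous fun s ↦ markFlow W (x i) s ω := fun i ↦
    Loewner.continuous_realFlowStop_of_ne hWc (hne i)
  have hzero : ∀ i, markFlow W (x i) 0 ω = x i := by
    intro i
    show Loewner.realFlowStop (W ω) (x i) 0 = x i
    rw [Loewner.realFlowStop_zero_of_ne hWc (hne i), hW0, sub_zero]
  -- the first flow is in `[m, M]` at every time `s ≤ u`
  have hX0 : ∀ s : ℝ≥0, s ≤ u → markFlow W (x 0) s ω ∈ Icc m M := by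
    intro s hs
    refine mem_Icc_of_le_exitTime (hcont 0) ?_ ?_
    · rw [hzero 0]; exact ⟨h.m_lt, h.lt_M⟩
    · exact (WithTop.coe_le_coe.2 hs).trans (hu.trans (min_le_left _ _))
  -- hence no swallowing, and `m ≤ X⁰ ≤ Xⁱ`
  have hswallow0 : ∀ s : ℝ≥0, s ≤ u → (s : WithTop ℝ≥0) < Loewner.swallowingTime (W ω) (x 0) := by
    intro s hs
    apply Loewner.coe_lt_swallowingTime_of_realFlowStop_ne_zero
    have := (hX0 s hs).1
    change m ≤ Loewner.realFlowStop (W ω) (x 0) s at this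
    intro h0
    rw [h0] at this
    linarith [h.m_pos]
  have hswallow : ∀ i, ∀ s : ℝ≥0, s ≤ u →
      (s : WithTop ℝ≥0) < Loewner.swallowingTime (W ω) (x i) := fun i s hs ↦
    lt_of_lt_of_le (hswallow0 s hs) (Loewner.swallowingTime_mono_right hWc (hW0lt 0) (hx0le i))
  have hlow : ∀ i, ∀ s : ℝ≥0, s ≤ u → m ≤ markFlow W (x i) s ω := by
    intro i s hs
    have h0s := (hX0 s hs).1
    have hmono : Loewner.realFlow (W ω) (x 0) s ≤ Loewner.realFlow (W ω) (x i) s :=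
      Loewner.realFlow_mono_right hWc (hW0lt 0) (hx0le i) (hswallow0 s hs)
    change m ≤ Loewner.realFlowStop (W ω) (x 0) s at h0s
    change m ≤ Loewner.realFlowStop (W ω) (x i) s
    rw [Loewner.realFlowStop_of_lt (hswallow0 s hs)] at h0s
    rw [Loewner.realFlowStop_of_lt (hswallow i s hs)]
    exact h0s.trans hmono
  -- the drift integrand is in `[0, 2/m]` on `[0, u]`
  have hintegrand : ∀ i, ∀ s ∈ Icc (0 : ℝ) u,
      0 ≤ (2 : ℝ) / markFlow W (x i) s.toNNReal ω ∧ (2 : ℝ) / markFlow W (x i) s.toNNReal ω ≤ 2 / m := by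
    intro i s hs
    have hs' : s.toNNReal ≤ u := Real.toNNReal_le_iff_le_coe.2 hs.2
    have hm := hlow i s.toNNReal hs'
    have hpos : 0 < markFlow W (x i) s.toNNReal ω := h.m_pos.trans_le hm
    exact ⟨div_nonneg zero_le_two hpos.le, div_le_div_of_nonneg_left zero_le_two h.m_pos hm⟩
  refine ⟨fun i ↦ hswallow i u le_rfl, hX0 u le_rfl, fun i ↦ ?_, fun i ↦ ?_, fun i ↦ ?_,
    fun i s hs ↦ hlow i s hs⟩
  · -- integrated Loewner equation for the frozen flow
    exact Loewner.realFlowStop_eq_sub_add_integral hWc (hne i) (hswallow i u le_rfl)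
  · exact intervalIntegral.integral_nonneg u.coe_nonneg fun s hs ↦ (hintegrand i s hs).1
  · have hb : ∀ s ∈ Ι (0 : ℝ) u, ‖(2 : ℝ) / markFlow W (x i) s.toNNReal ω‖ ≤ 2 / m := by
      intro s hs
      rw [uIoc_of_le u.coe_nonneg] at hs
      obtain ⟨h1, h2⟩ := hintegrand i s ⟨hs.1.le, hs.2⟩
      rw [Real.norm_eq_abs, abs_of_nonneg h1]
      exact h2
    have := intervalIntegral.norm_integral_le_of_norm_le_const hb
    rw [Real.norm_eq_abs, sub_zero, abs_of_nonneg u.coe_nonneg] at this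
    have h2 : 2 / m * (u : ℝ) = 2 * u / m := by ring
    exact (le_abs_self _).trans (this.trans h2.le)

/-- **Every mark stays close to its starting point up to the level time**:
`|Xⁱ_u - xᵢ| ≤ max (x₀ - m) (M - x₀) + 2u/m` for `u ≤ levelTime` (the driver is read off the
first flow, `W_u = x₀ + I⁰_u - X⁰_u`, and the drift integrals are in `[0, 2u/m]`). [folklore] -/
theorem abs_markFlow_sub_le_of_le_levelTime (hWc : Continuous (W ω)) (hW0 : W ω 0 = 0)
    (h : AdmissibleLevels x m M d) {u : ℝ≥0}
    (hu : (u : WithTop ℝ≥0) ≤ levelTime W x m M d ω) (i : Fin 3) :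
    |markFlow W (x i) u ω - x i| ≤ max (x 0 - m) (M - x 0) + 2 * u / m := by
  obtain ⟨-, hX0, hrep, hI0, hIle, -⟩ := flows_of_le_levelTime hWc hW0 h hu
  have h0 := hrep 0
  have hi := hrep i
  have hI0₀ := hI0 0
  have hIle₀ := hIle 0
  have hI0ᵢ := hI0 i
  have hIleᵢ := hIle i
  rw [abs_le]
  constructor
  · have : x 0 - m ≤ max (x 0 - m) (M - x 0) := le_max_left _ _
    linarith [hX0.1]
  · have : M - x 0 ≤ max (x 0 - m) (M - x 0) := le_max_right _ _
    linarith [hX0.2]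

/-- **On the event `sup_{s ≤ t} |W_s| ≤ K` no level is reached before time `t`** when
`K < x₀ - m`, `K + 2t/m < M - x₀` and `2t/m < min (x₁ - x₀ - d) (x₂ - x₁ - d)`, `2t/m < 1`.
[folklore] -/
theorem coe_lt_levelTime_of_forall_abs_le (hWc : Continuous (W ω)) (hW0 : W ω 0 = 0)
    (h : AdmissibleLevels x m M d) {t : ℝ≥0} {K : ℝ}
    (hK : ∀ s : ℝ≥0, s ≤ t → |W ω s| ≤ K) (hK1 : K < x 0 - m) (hK2 : K + 2 * t / m < M - x 0)
    (hg1 : 2 * t / m < x 1 - x 0 - d) (hg2 : 2 * t / m < x 2 - x 1 - d) (hg3 : 2 * t / m < 1) :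
    (t : WithTop ℝ≥0) < levelTime W x m M d ω := by
  by_contra hle
  rw [not_lt] at hle
  have hne : levelTime W x m M d ω ≠ ⊤ := ne_top_of_le_ne_top WithTop.coe_ne_top hle
  obtain ⟨T, hT⟩ := WithTop.ne_top_iff_exists.1 hne
  have hTt : T ≤ t := by rw [← hT] at hle; exact WithTop.coe_le_coe.1 hle
  have hTle : ((T : WithTop ℝ≥0)) ≤ levelTime W x m M d ω := by rw [← hT]
  obtain ⟨-, -, hrep, hI0, hIle, -⟩ := flows_of_le_levelTime hWc hW0 h hTle
  have hKT := hK T hTt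
  have hmpos := h.m_pos
  have hTm : 2 * (T : ℝ) / m ≤ 2 * t / m := by
    have : (T : ℝ) ≤ t := by exact_mod_cast hTt
    gcongr
  have hx0 : 0 < x 0 := h.pos
  have hne' : ∀ i, x i ≠ W ω 0 := fun i ↦ by
    rw [hW0]; exact (hx0.trans_le (h.strictMono.monotone (Fin.zero_le i))).ne'
  have hcont : ∀ i, Continuous fun s ↦ markFlow W (x i) s ω := fun i ↦
    Loewner.continuous_realFlowStop_of_ne hWc (hne' i)
  have hzero : ∀ i, markFlow W (x i) 0 ω = x i := by
    intro i
    show Loewner.realFlowStop (W ω) (x i) 0 = x i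
    rw [Loewner.realFlowStop_zero_of_ne hWc (hne' i), hW0, sub_zero]
  have hx01 : x 0 < x 1 := h.strictMono (by decide)
  have hx12 : x 1 < x 2 := h.strictMono (by decide)
  have hWT := abs_le.1 hKT
  -- which of the three exit times is the level time `T`
  have hcases : exitTime (markFlow W (x 0)) m M ω = T ∨
      exitTime (fun t ω ↦ markFlow W (x 1) t ω - markFlow W (x 0) t ω) d (x 2 - x 0 + 1) ω = T ∨
      exitTime (fun t ω ↦ markFlow W (x 2) t ω - markFlow W (x 1) t ω) d (x 2 - x 0 + 1) ω = T := by
    have h' : min (exitTime (markFlow W (x 0)) m M ω)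
        (min (exitTime (fun t ω ↦ markFlow W (x 1) t ω - markFlow W (x 0) t ω) d (x 2 - x 0 + 1) ω)
          (exitTime (fun t ω ↦ markFlow W (x 2) t ω - markFlow W (x 1) t ω) d (x 2 - x 0 + 1) ω)) =
        T := hT.symm
    rcases min_eq_iff.1 h' with ⟨h1, -⟩ | ⟨h1, -⟩
    · exact Or.inl h1
    · rcases min_eq_iff.1 h1 with ⟨h2, -⟩ | ⟨h2, -⟩
      · exact Or.inr (Or.inl h2)
      · exact Or.inr (Or.inr h2)
  rcases hcases with h0 | h1 | h2
  · -- the first flow would sit at `m` or `M`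
    have hend := Literature.Probability.Process.apply_eq_or_eq_of_exitTime_eq_coe (hcont 0)
      (by rw [hzero 0]; exact ⟨h.m_lt, h.lt_M⟩) h0
    have hr := hrep 0
    have h1 := hI0 0
    have h2 := hIle 0
    rcases hend with he | he <;> linarith
  · -- the first gap would sit at `d` or `x₂ - x₀ + 1`
    have hend := Literature.Probability.Process.apply_eq_or_eq_of_exitTime_eq_coe
      (u := fun t ω ↦ markFlow W (x 1) t ω - markFlow W (x 0) t ω) ((hcont 1).sub (hcont 0))
      (by show markFlow W (x 1) 0 ω - markFlow W (x 0) 0 ω ∈ Ioo d (x 2 - x 0 + 1)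
          rw [hzero 1, hzero 0]; exact ⟨h.d_lt₁, by linarith⟩) h1
    have hr0 := hrep 0
    have hr1 := hrep 1
    have h10 := hI0 0
    have h11 := hI0 1
    have h20 := hIle 0
    have h21 := hIle 1
    rcases hend with he | he <;> linarith
  · -- the second gap would sit at `d` or `x₂ - x₀ + 1`
    have hend := Literature.Probability.Process.apply_eq_or_eq_of_exitTime_eq_coe
      (u := fun t ω ↦ markFlow W (x 2) t ω - markFlow W (x 1) t ω) ((hcont 2).sub (hcont 1))
      (by show markFlow W (x 2) 0 ω - markFlow W (x 1) 0 ω ∈ Ioo d (x 2 - x 0 + 1)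
          rw [hzero 2, hzero 1]; exact ⟨h.d_lt₂, by linarith⟩) h2
    have hr1 := hrep 1
    have hr2 := hrep 2
    have h11 := hI0 1
    have h12 := hI0 2
    have h21 := hIle 1
    have h22 := hIle 2
    rcases hend with he | he <;> linarith

/-- **The drift integral in the far field.**  On `sup_{s ≤ t} |W_s| ≤ K` with `K < xᵢ` and
`t ≤ levelTime`, `|∫₀ᵗ 2/Xⁱ_s ds - 2t/xᵢ| ≤ 2t (K + 2t/m)/((xᵢ - K) xᵢ)`: the flow is within
`K + 2t/m` of `xᵢ` on `[0, t]`. [folklore] -/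
theorem abs_driftIntegral_sub_le (hWc : Continuous (W ω)) (hW0 : W ω 0 = 0)
    (h : AdmissibleLevels x m M d) {t : ℝ≥0} {K : ℝ}
    (hK : ∀ s : ℝ≥0, s ≤ t → |W ω s| ≤ K) (ht : (t : WithTop ℝ≥0) ≤ levelTime W x m M d ω)
    (i : Fin 3) (hKi : K < x i) :
    |(∫ s in (0 : ℝ)..(t : ℝ), (2 : ℝ) / markFlow W (x i) s.toNNReal ω) - 2 * t / x i| ≤
      2 * t * ((K + 2 * t / m) / ((x i - K) * x i)) := by
  have hx0 : 0 < x 0 := h.pos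
  have hxi : 0 < x i := hx0.trans_le (h.strictMono.monotone (Fin.zero_le i))
  have hK0 : 0 ≤ K := (abs_nonneg _).trans (hK 0 zero_le)
  have hmpos := h.m_pos
  have hne' : x i ≠ W ω 0 := by rw [hW0]; exact hxi.ne'
  have hcont : Continuous fun s ↦ markFlow W (x i) s ω :=
    Loewner.continuous_realFlowStop_of_ne hWc hne'
  -- pointwise: the flow is within `K + 2t/m` of `x i` on `[0, t]`, and at least `m`
  have hpt : ∀ s ∈ Icc (0 : ℝ) t,
      (x i - K ≤ markFlow W (x i) s.toNNReal ω ∧ markFlow W (x i) s.toNNReal ω ≤ x i + K + 2 * t / m) ∧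
        m ≤ markFlow W (x i) s.toNNReal ω := by
    intro s hs
    have hs' : s.toNNReal ≤ t := Real.toNNReal_le_iff_le_coe.2 hs.2
    have hsle : ((s.toNNReal : ℝ≥0) : WithTop ℝ≥0) ≤ levelTime W x m M d ω :=
      (WithTop.coe_le_coe.2 hs').trans ht
    obtain ⟨-, -, hrep, hI0, hIle, hlow⟩ := flows_of_le_levelTime hWc hW0 h hsle
    have hr := hrep i
    have h1 := hI0 i
    have h2 := hIle i
    have hW := abs_le.1 (hK _ hs')
    have h3 : 2 * ((s.toNNReal : ℝ≥0) : ℝ) / m ≤ 2 * t / m := by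
      have : ((s.toNNReal : ℝ≥0) : ℝ) ≤ t := by exact_mod_cast hs'
      gcongr
    refine ⟨⟨by linarith, by linarith⟩, hlow i _ le_rfl⟩
  -- pointwise bound on the integrand difference
  have hxK : 0 < x i - K := by linarith
  have hbd : ∀ s ∈ Ι (0 : ℝ) t,
      ‖(2 : ℝ) / markFlow W (x i) s.toNNReal ω - 2 / x i‖ ≤ 2 * ((K + 2 * t / m) / ((x i - K) * x i)) := by
    intro s hs
    rw [uIoc_of_le t.coe_nonneg] at hs
    obtain ⟨⟨hXge, hXle⟩, hm⟩ := hpt s ⟨hs.1.le, hs.2⟩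
    set X := markFlow W (x i) s.toNNReal ω with hX
    have hXpos : 0 < X := hmpos.trans_le hm
    have hdiff : (2 : ℝ) / X - 2 / x i = 2 * ((x i - X) / (X * x i)) := by
      field_simp
    rw [hdiff, norm_mul, Real.norm_eq_abs, abs_two, Real.norm_eq_abs, abs_div,
      abs_of_pos (mul_pos hXpos hxi)]
    refine mul_le_mul_of_nonneg_left ?_ zero_le_two
    have h2t : 0 ≤ 2 * (t : ℝ) / m := by positivity
    have hnum : |x i - X| ≤ K + 2 * t / m := abs_le.2 ⟨by linarith, by linarith⟩
    calc |x i - X| / (X * x i) ≤ (K + 2 * t / m) / (X * x i) := by gcongr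
      _ ≤ (K + 2 * t / m) / ((x i - K) * x i) :=
          div_le_div_of_nonneg_left (by positivity) (by positivity)
            (mul_le_mul_of_nonneg_right hXge hxi.le)
  -- integrate
  have hcint : IntervalIntegrable (fun s : ℝ ↦ (2 : ℝ) / markFlow W (x i) s.toNNReal ω) volume 0 t := by
    refine (continuousOn_const.div ((hcont.comp continuous_real_toNNReal).continuousOn) ?_
      ).intervalIntegrable_of_Icc t.coe_nonneg
    intro s hs
    exact (hmpos.trans_le (hpt s hs).2).ne'
  have hsub : (∫ s in (0 : ℝ)..(t : ℝ), (2 : ℝ) / markFlow W (x i) s.toNNReal ω) - 2 * t / x i =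
      ∫ s in (0 : ℝ)..(t : ℝ), ((2 : ℝ) / markFlow W (x i) s.toNNReal ω - 2 / x i) := by
    rw [intervalIntegral.integral_sub hcint intervalIntegrable_const, intervalIntegral.integral_const]
    simp only [sub_zero, smul_eq_mul]
    ring
  rw [hsub]
  have := intervalIntegral.norm_integral_le_of_norm_le_const hbd
  rw [Real.norm_eq_abs, sub_zero, abs_of_nonneg t.coe_nonneg] at this
  calc _ ≤ 2 * ((K + 2 * t / m) / ((x i - K) * x i)) * t := this
    _ = 2 * t * ((K + 2 * t / m) / ((x i - K) * x i)) := by ring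

/-- **Registered form** (glue sub-goal `farField_abs_markFlow_sub_le` of stmt-CriticalPhenomena-0746):
every mark stays within `max (x₀ - m) (M - x₀) + 2u/m` of its starting point up to the level time.
[folklore] -/
theorem farField_abs_markFlow_sub_le : ∀ {Ω : Type*} {W : Ω → ℝ≥0 → ℝ} {ω : Ω} {x : Fin 3 → ℝ} {m M d : ℝ}, Continuous (W ω) → W ω 0 = 0 → AdmissibleLevels x m M d → ∀ {u : ℝ≥0}, (u : WithTop ℝ≥0) ≤ levelTime W x m M d ω → ∀ i : Fin 3, |markFlow W (x i) u ω - x i| ≤ max (x 0 - m) (M - x 0) + 2 * u / m :=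
  fun hWc hW0 h _ hu i ↦ abs_markFlow_sub_le_of_le_levelTime hWc hW0 h hu i

end FarField

end Summit.CriticalPhenomena.CardyFormulaZ2.Cruxes.CardyRigidity.CrossingMartingale

end
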